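import Mathlib
import Literature.MathematicalPhysics.StatisticalMechanics.LennardJonesClusters

/-!
# `StabilityConstantTwelve` — the `d = 4` threshold certificate (companion to `Disproof.lean`)

Kernel-decided (`decide +kernel`, no `native_decide`, standard axioms), via the evaluation machine
`Cert.*` of `Disproof.lean` (copied verbatim, namespace `…Disproof.HeavyD4`); the 409-point
certificate is split into five row blocks (`hsumB`) of ≤ 60 s kernel time each (~4 min in all).

* `d4_energy_le : groundStateEnergy lennardJones 4 409 ≤ -420` — the `D₄` ball
  `{v ∈ ℤ⁴ : ∑ vᵢ even, |v|² ≤ 12}` at nearest-neighbour distance `√0.92` (exact `-426.457…`),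
  hence `not_stability_dim4 : ¬ ∀ N, -N ≤ E_{ℝ⁴}(N)`: THE DIMENSION THRESHOLD OF THE CRUX IS
  EXACTLY `3 → 4` (lattice sums: `e(D₄) = -A₆²/(24 A₁₂) ≈ -2.15`, `A₆ ≈ 35.6`, `A₁₂ ≈ 24.53`;
  `e(fcc) = -0.7175`; `e(D₅) ≈ -9.8`; `d ≥ 6` not even stable).
-/

noncomputable section

namespace Summit.AtomisticToContinuum.Crystallization.Cruxes.StabilityConstantTwelve.Disproof.HeavyD4

open Literature.MathematicalPhysics.StatisticalMechanics

namespace Cert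

/-! Certified evaluation machine, version 2 (natural-number rows, one-pass distance histogram):
a configuration is given by rows `L : List (List ℕ)` (coordinates, any common translate) and a
rational scale `s`; its points are `√s · L[i]`, and `2 E = hsum L s ∈ ℚ` exactly, decided by the
kernel (`decide +kernel`; `Nat` arithmetic is GMP-accelerated there, hence `ℕ` rows). -/

/-- `(a - b)²` computed inside `ℕ` (no truncation: `2ab ≤ a² + b²`). -/
def sqDiffN (a b : ℕ) : ℕ := a * a + b * b - 2 * a * b

/-- squared distance of two rows. -/
def sqDistN : List ℕ → List ℕ → ℕ
  | a :: u, b :: v => sqDiffN a b + sqDistN u v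
  | _, _ => 0

/-- `V_LJ` as a function of the SQUARED distance, over `ℚ` and over `ℝ`. -/
def Wq (q : ℚ) : ℚ := (1 / 12) * (q⁻¹) ^ 6 - (1 / 6) * (q⁻¹) ^ 3
def W (q : ℝ) : ℝ := (1 / 12) * (q⁻¹) ^ 6 - (1 / 6) * (q⁻¹) ^ 3

/-- twice the energy as the plain double sum (specification). -/
def dsum (L : List (List ℕ)) (s : ℚ) : ℚ :=
  (L.map fun u => (L.map fun v => Wq (s * sqDistN u v)).sum).sum

/-- histogram update (association list `squared distance ↦ count`). -/
def incr : List (ℕ × ℕ) → ℕ → List (ℕ × ℕ)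
  | [], m => [(m, 1)]
  | (m', c) :: t, m => if m' = m then (m', c + 1) :: t else (m', c) :: incr t m

/-- histogram of the squared distances from the row `u` to all rows of `L` (one row at a time:
this bounds the depth of unevaluated accumulators in the kernel by `|L|`). -/
def rowHist (L : List (List ℕ)) (u : List ℕ) : List (ℕ × ℕ) :=
  L.foldl (fun acc v => incr acc (sqDistN u v)) []

/-- twice the energy, evaluated row by row through histograms (what the kernel computes). -/
def hsum (L : List (List ℕ)) (s : ℚ) : ℚ :=
  (L.map fun u => ((rowHist L u).map fun p => (p.2 : ℚ) * Wq (s * p.1)).sum).sum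

/-- all rows of length `d` with entries in `[0, 2r]`. -/
def boxVecs : ℕ → ℕ → List (List ℕ)
  | 0, _ => [[]]
  | d + 1, r => (boxVecs d r).flatMap fun v => (List.range (2 * r + 1)).map fun k => k :: v

/-- squared norm of the centred row `v - (r,…,r)`. -/
def normSqC (r : ℕ) (v : List ℕ) : ℕ := (v.map fun a => sqDiffN a r).sum

/-- the `Dₙ`-type ball, translated by `(r,…,r)`: rows `v ∈ [0,2r]ᵈ` with `∑ (vᵢ - r)` even and
`|v - (r,…,r)|² ≤ R2` (`d = 3`: fcc balls; centre included). -/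
def dBall (d r R2 : ℕ) : List (List ℕ) :=
  (boxVecs d r).filter fun v => decide ((v.sum + d * r) % 2 = 0 ∧ normSqC r v ≤ R2)

/-- the real configuration with coordinates `√s · L[i][k]`. -/
def config (d : ℕ) (s : ℚ) (L : List (List ℕ)) : Fin L.length → EuclideanSpace ℝ (Fin d) :=
  fun i => WithLp.toLp 2 fun k : Fin d => Real.sqrt s * (((L.get i).getD (k : ℕ) 0 : ℕ) : ℝ)

theorem cast_sqDiffN (a b : ℕ) : ((sqDiffN a b : ℕ) : ℝ) = ((a : ℝ) - b) ^ 2 := by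
  unfold sqDiffN
  have h : 2 * a * b ≤ a * a + b * b := by nlinarith [sq_nonneg ((a : ℤ) - b)]
  rw [Nat.cast_sub h]
  push_cast
  ring

theorem lennardJones_eq_W (r : ℝ) : lennardJones r = W (r ^ 2) := by
  simp only [lennardJones, W, inv_pow, ← pow_mul]

theorem W_cast (q : ℚ) : W (q : ℝ) = (Wq q : ℝ) := by
  simp only [W, Wq]; push_cast; ring

theorem sum_sq_getD : ∀ (d : ℕ) (u v : List ℕ), u.length = d → v.length = d →
    ∑ k : Fin d, (((u.getD (k : ℕ) 0 : ℕ) : ℝ) - ((v.getD (k : ℕ) 0 : ℕ) : ℝ)) ^ 2 = (sqDistN u v : ℝ)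
  | 0, [], [], _, _ => by simp [sqDistN]
  | d + 1, a :: u, b :: v, hu, hv => by
    rw [Fin.sum_univ_succ]
    simp only [Fin.val_zero, List.getD_cons_zero, Fin.val_succ, List.getD_cons_succ, sqDistN,
      Nat.cast_add, cast_sqDiffN]
    rw [sum_sq_getD d u v (by simpa using hu) (by simpa using hv)]
  | 0, _ :: _, _, hu, _ => by simp at hu
  | 0, [], _ :: _, _, hv => by simp at hv
  | _ + 1, [], _, hu, _ => by simp at hu
  | _ + 1, _ :: _, [], _, hv => by simp at hv

theorem dist_sq_config {d : ℕ} {s : ℚ} (hs : 0 ≤ s) {L : List (List ℕ)}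
    (hL : ∀ r ∈ L, r.length = d) (i j : Fin L.length) :
    dist (config d s L i) (config d s L j) ^ 2 = (s : ℝ) * (sqDistN (L.get i) (L.get j) : ℝ) := by
  rw [EuclideanSpace.dist_eq, Real.sq_sqrt (Finset.sum_nonneg fun _ _ => sq_nonneg _)]
  have hi := hL _ (List.get_mem L i)
  have hj := hL _ (List.get_mem L j)
  rw [← sum_sq_getD d _ _ hi hj, Finset.mul_sum]
  refine Finset.sum_congr rfl fun k _ => ?_
  simp only [config, PiLp.toLp_apply, dist_eq_norm, Real.norm_eq_abs, sq_abs]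
  rw [← mul_sub, mul_pow, Real.sq_sqrt (by exact_mod_cast hs)]

theorem lennardJones_dist_config {d : ℕ} {s : ℚ} (hs : 0 ≤ s) {L : List (List ℕ)}
    (hL : ∀ r ∈ L, r.length = d) (i j : Fin L.length) :
    lennardJones (dist (config d s L i) (config d s L j)) =
      (Wq (s * sqDistN (L.get i) (L.get j)) : ℝ) := by
  rw [lennardJones_eq_W, dist_sq_config hs hL, ← W_cast]
  push_cast; rfl

theorem sum_fin_get {α β : Type*} [AddCommMonoid β] (L : List α) (g : α → β) :
    ∑ i : Fin L.length, g (L.get i) = (L.map g).sum := by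
  rw [← List.sum_ofFn, ← List.ofFn_getElem_eq_map]
  rfl

/-- `2 E(config) = dsum L s`. -/
theorem two_mul_interactionEnergy_config {d : ℕ} {s : ℚ} (hs : 0 ≤ s) {L : List (List ℕ)}
    (hL : ∀ r ∈ L, r.length = d) :
    2 * interactionEnergy lennardJones (config d s L) = (dsum L s : ℝ) := by
  rw [two_mul_interactionEnergy_eq_sum_sum lennardJones lennardJones_zero]
  simp_rw [lennardJones_dist_config hs hL]
  have h : ∀ i : Fin L.length, ∑ k : Fin L.length, ((Wq (s * sqDistN (L.get i) (L.get k)) : ℚ) : ℝ)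
      = (((L.map fun v => Wq (s * sqDistN (L.get i) v)).sum : ℚ) : ℝ) := fun i => by
    rw [← sum_fin_get L (fun v => Wq (s * sqDistN (L.get i) v))]
    push_cast
    rfl
  simp_rw [h]
  rw [dsum, ← sum_fin_get L (fun u => (L.map fun v => Wq (s * sqDistN u v)).sum)]
  push_cast
  rfl

/-! #### correctness of the histogram evaluation: `hsum = dsum` -/

theorem sum_map_incr (s : ℚ) (acc : List (ℕ × ℕ)) (m : ℕ) :
    ((incr acc m).map fun p => (p.2 : ℚ) * Wq (s * p.1)).sum =
      (acc.map fun p => (p.2 : ℚ) * Wq (s * p.1)).sum + Wq (s * m) := by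
  induction acc with
  | nil => simp [incr]
  | cons p t ih =>
    obtain ⟨m', c⟩ := p
    by_cases h : m' = m
    · subst h
      simp only [incr, if_true, List.map_cons, List.sum_cons]
      push_cast; ring
    · simp only [incr, if_neg h, List.map_cons, List.sum_cons, ih]
      ring

theorem sum_map_foldl_incr (s : ℚ) (u : List ℕ) :
    ∀ (L : List (List ℕ)) (acc : List (ℕ × ℕ)),
    ((L.foldl (fun acc' v => incr acc' (sqDistN u v)) acc).map fun p => (p.2 : ℚ) * Wq (s * p.1)).sum =
      (acc.map fun p => (p.2 : ℚ) * Wq (s * p.1)).sum + (L.map fun v => Wq (s * sqDistN u v)).sum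
  | [], acc => by simp
  | v :: t, acc => by
    rw [List.foldl_cons, sum_map_foldl_incr s u t, sum_map_incr]
    simp only [List.map_cons, List.sum_cons]
    ring

theorem hsum_eq_dsum (L : List (List ℕ)) (s : ℚ) : hsum L s = dsum L s := by
  rw [hsum, dsum]
  congr 1
  refine List.map_congr_left fun u _ => ?_
  rw [rowHist, sum_map_foldl_incr]
  simp

/-- partial sum over a BLOCK of rows `B` against all rows of `L` (lets a long certificate be
split over several declarations, each within the farm's per-declaration kernel budget). -/
def hsumB (B L : List (List ℕ)) (s : ℚ) : ℚ :=
  (B.map fun u => ((rowHist L u).map fun p => (p.2 : ℚ) * Wq (s * p.1)).sum).sum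

theorem hsum_eq_hsumB (L : List (List ℕ)) (s : ℚ) : hsum L s = hsumB L L s := rfl

theorem hsumB_append (B₁ B₂ L : List (List ℕ)) (s : ℚ) :
    hsumB (B₁ ++ B₂) L s = hsumB B₁ L s + hsumB B₂ L s := by
  simp [hsumB, List.map_append, List.sum_append]

/-- first block. -/
theorem hsumB_split (B L : List (List ℕ)) (s : ℚ) (n : ℕ) :
    hsumB B L s = hsumB (B.take n) L s + hsumB (B.drop n) L s := by
  conv_lhs => rw [← List.take_append_drop n B]
  rw [hsumB_append]

/-- peel the next block of `n` rows off `L.drop a`. -/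
theorem hsumB_drop_split (B L : List (List ℕ)) (s : ℚ) (a n : ℕ) :
    hsumB (B.drop a) L s = hsumB ((B.drop a).take n) L s + hsumB (B.drop (a + n)) L s := by
  conv_lhs => rw [← List.take_append_drop n (B.drop a)]
  rw [hsumB_append, List.drop_drop]

/-- injectivity from `Nodup` rows of the right length and `s ≠ 0`. -/
theorem config_injective {d : ℕ} {s : ℚ} (hs : 0 < s) {L : List (List ℕ)}
    (hL : ∀ r ∈ L, r.length = d) (hN : L.Nodup) : Function.Injective (config d s L) := by
  intro i j hij
  have hrow : L.get i = L.get j := by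
    apply List.ext_getElem ((hL _ (List.get_mem L i)).trans (hL _ (List.get_mem L j)).symm)
    intro k hki hkj
    have hk : k < d := (hL _ (List.get_mem L i)) ▸ hki
    have h := congrArg (fun v : EuclideanSpace ℝ (Fin d) => v ⟨k, hk⟩) hij
    simp only [config, PiLp.toLp_apply] at h
    have hs' : Real.sqrt s ≠ 0 := (Real.sqrt_pos.2 (by exact_mod_cast hs)).ne'
    have h' := mul_left_cancel₀ hs' h
    have h'' : (L.get i).getD k 0 = (L.get j).getD k 0 := by exact_mod_cast h'
    rw [List.getD_eq_getElem _ _ hki, List.getD_eq_getElem _ _ hkj] at h''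
    exact h''
  exact (List.nodup_iff_injective_get.1 hN) hrow

/-- MASTER LEMMA: a kernel-checked rational certificate `hsum L s ≤ 2b` bounds `E(N) ≤ b`. -/
theorem groundStateEnergy_le_of_cert {d : ℕ} {s : ℚ} (hs : 0 < s) {L : List (List ℕ)}
    (hL : ∀ r ∈ L, r.length = d) (hN : L.Nodup) {b : ℚ} (hb : hsum L s ≤ 2 * b) :
    groundStateEnergy lennardJones d L.length ≤ b := by
  have h1 := groundStateEnergy_lennardJones_le (config_injective hs hL hN)
  have h2 := two_mul_interactionEnergy_config hs.le hL
  rw [hsum_eq_dsum] at hb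
  have hb' : ((dsum L s : ℚ) : ℝ) ≤ 2 * b := by exact_mod_cast hb
  linarith

/-! #### site energies, separation and half-space conditions read off the rows -/

/-- the site energy of row `i`, in closed rational form. -/
theorem siteEnergy_config {d : ℕ} {s : ℚ} (hs : 0 ≤ s) {L : List (List ℕ)}
    (hL : ∀ r ∈ L, r.length = d) (i : Fin L.length) :
    siteEnergy lennardJones (config d s L) i =
      (((L.map fun v => Wq (s * sqDistN (L.get i) v)).sum : ℚ) : ℝ) := by
  have h0 : lennardJones (dist (config d s L i) (config d s L i)) = 0 := by
    rw [dist_self, lennardJones_zero]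
  unfold siteEnergy
  rw [← add_zero (Finset.sum _ _), ← h0, Finset.sum_erase_add _ _ (Finset.mem_univ i)]
  simp_rw [lennardJones_dist_config hs hL]
  rw [← sum_fin_get L (fun v => Wq (s * sqDistN (L.get i) v))]
  push_cast
  rfl

/-- row-level separation certificate: distinct rows are at squared distance `≥ δ2 / s`. -/
def SepRows (L : List (List ℕ)) (s δ2 : ℚ) : Prop :=
  ∀ u ∈ L, ∀ v ∈ L, u = v ∨ δ2 ≤ s * sqDistN u v

instance (L : List (List ℕ)) (s δ2 : ℚ) : Decidable (SepRows L s δ2) := by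
  unfold SepRows; infer_instance

theorem sep_config {d : ℕ} {s : ℚ} (hs : 0 ≤ s) {L : List (List ℕ)}
    (hL : ∀ r ∈ L, r.length = d) (hN : L.Nodup) {δ : ℝ} {δ2 : ℚ}
    (hδ2 : δ ^ 2 = (δ2 : ℝ)) (hsep : SepRows L s δ2) (j k : Fin L.length) (hjk : j ≠ k) :
    δ ≤ dist (config d s L j) (config d s L k) := by
  have hne : L.get j ≠ L.get k := fun h => hjk ((List.nodup_iff_injective_get.1 hN) h)
  have h2 : (δ2 : ℝ) ≤ (s : ℝ) * (sqDistN (L.get j) (L.get k) : ℝ) := by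
    rcases hsep _ (List.get_mem L j) _ (List.get_mem L k) with h | h
    · exact absurd h hne
    · exact_mod_cast h
  rw [← dist_sq_config hs hL] at h2
  rw [← hδ2] at h2
  by_contra hlt
  rw [not_le] at hlt
  nlinarith [dist_nonneg (x := config d s L j) (y := config d s L k)]

/-- row-level half-space certificate (direction `e₃`): every row's third coordinate is at most
that of row `i`. -/
theorem halfspace_config {s : ℚ} {L : List (List ℕ)} (i : Fin L.length)
    (hz : ∀ v ∈ L, v.getD 2 0 ≤ (L.get i).getD 2 0) (j : Fin L.length) :
    inner ℝ (config 3 s L j - config 3 s L i) (EuclideanSpace.single (2 : Fin 3) (1 : ℝ)) ≤ 0 := by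
  rw [EuclideanSpace.inner_single_right]
  simp only [one_mul, PiLp.sub_apply, config, Fin.isValue, Fin.val_two, conj_trivial]
  have h := hz _ (List.get_mem L j)
  have h' : (((L.get j).getD 2 0 : ℕ) : ℝ) ≤ ((L.get i).getD 2 0 : ℕ) := by exact_mod_cast h
  have hs0 : 0 ≤ Real.sqrt s := Real.sqrt_nonneg _
  have := mul_le_mul_of_nonneg_left h' hs0
  linarith

end Cert

open Cert

/-- `D₄` ball `|v|² ≤ 12` (translated by `(3,3,3,3)`): 409 rows. -/
def d4Rows : List (List ℕ) := dBall 4 3 12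

set_option maxHeartbeats 40000000 in
theorem d4_block0 : hsumB (d4Rows.take 82) d4Rows (23 / 50) ≤ -3751 / 25 := by decide +kernel
set_option maxHeartbeats 40000000 in
theorem d4_block1 : hsumB ((d4Rows.drop 82).take 82) d4Rows (23 / 50) ≤ -17451 / 100 := by
  decide +kernel
set_option maxHeartbeats 40000000 in
theorem d4_block2 : hsumB ((d4Rows.drop 164).take 82) d4Rows (23 / 50) ≤ -4889 / 25 := by
  decide +kernel
set_option maxHeartbeats 40000000 in
theorem d4_block3 : hsumB ((d4Rows.drop 246).take 82) d4Rows (23 / 50) ≤ -17451 / 100 := by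
  decide +kernel
set_option maxHeartbeats 40000000 in
theorem d4_block4 : hsumB (d4Rows.drop 328) d4Rows (23 / 50) ≤ -14827 / 100 := by decide +kernel

/-- the five blocks add up: `2 E ≤ -852.89 ≤ -840`. -/
theorem d4_hsum_le : hsum d4Rows (23 / 50) ≤ 2 * (-420) := by
  have h0 := d4_block0; have h1 := d4_block1; have h2 := d4_block2; have h3 := d4_block3
  have h4 := d4_block4
  rw [hsum_eq_hsumB, hsumB_split _ _ _ 82, hsumB_drop_split _ _ _ 82 82,
    hsumB_drop_split _ _ _ (82 + 82) 82, hsumB_drop_split _ _ _ (82 + 82 + 82) 82]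
  norm_num only
  norm_num only at h0 h1 h2 h3 h4
  linarith

set_option maxHeartbeats 40000000 in
/-- `d = 4`: `E(409) ≤ -420 < -409` (exact `-426.457…` at `s = 23/50`). -/
theorem d4_energy_le : groundStateEnergy lennardJones 4 409 ≤ -(420 : ℝ) := by
  have h := groundStateEnergy_le_of_cert (d := 4) (s := 23 / 50) (by norm_num) (L := d4Rows)
    (by decide +kernel) (by decide +kernel) (b := -420) d4_hsum_le
  have hl : d4Rows.length = 409 := by decide +kernel
  rw [hl] at h
  exact h.trans (by norm_num)

/-- THE DIMENSION THRESHOLD IS `3 → 4`: the `ℝ⁴` analogue of `StabilityConstantTwelve` is false. -/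
theorem not_stability_dim4 : ¬ ∀ N : ℕ, -(N : ℝ) ≤ groundStateEnergy lennardJones 4 N := by
  intro h; have h1 := h 409; norm_num at h1; linarith [d4_energy_le]

end Summit.AtomisticToContinuum.Crystallization.Cruxes.StabilityConstantTwelve.Disproof.HeavyD4
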